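import Mathlib
import HarnessLib
import HarnessLib.Audit
import Summits.Langlands.Statement
import Summits.Langlands.Langlands.Theses.TameDarkSplit
import Summits.Langlands.Langlands.Theses.ImageOrderLadder
import Summits.Langlands.Langlands.Theses.DescentCoprimalityLadder

set_option linter.dupNamespace false

open scoped BigOperators Topology Manifold Classical MeasureTheory ProbabilityTheory Matrix InnerProductSpace ComplexConjugate ContinuousMap
open Filter Set Function TopologicalSpace MeasureTheory

/-! # BC3 birth skeleton for `Summit.Langlands.Langlands.Theses.DescentCoprimalityLadder.OctahedralMonomialArtinAutomorphy` — after-birth form (imports the child route file; conclusion = the route decl BY NAME;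
closed candidate `OctahedralMonomialArtinAutomorphy_proof : Summit.Langlands.Langlands.Theses.DescentCoprimalityLadder.OctahedralMonomialArtinAutomorphy` = composition applied to the two sorried stubs). -/

namespace Summit.Langlands.Langlands.Cruxes.OctahedralMonomialArtinAutomorphy.Birth

/-- rung (4,2), essentially self-dual members (e.g. Ind of a quadratic character: signed permutation matrices ⊂ O₄): GO(4)-type ⇒ PRINT (Ramakrishnan 2002) -/
theorem stub_octSelfDual :
  ∀ (K : Type) [Field K] [NumberField K], NumberField.IsTotallyReal K → ∀ (n : ℕ) (hcpt : Literature.NumberTheory.Automorphic.isCompact_glFiniteIntegralLevel n K), 0 < n → ∀ (ℓ : ℕ) [Fact ℓ.Prime] (ι : PadicAlgCl ℓ ≃+* ℂ) (ρ : Literature.NumberTheory.GaloisRepresentations.FramedGaloisRep K (PadicAlgCl ℓ) n), ρ.toGaloisRep.IsIrreducible → ((∀ᶠ v : IsDedekindDomain.HeightOneSpectrum (NumberField.RingOfIntegers K) in Filter.cofinite, ρ.IsUnramifiedAt v) ∧ ∀ (v : IsDedekindDomain.HeightOneSpectrum (NumberField.RingOfIntegers K)) (hv : ((ℓ : ℕ)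 : NumberField.RingOfIntegers K) ∈ v.asIdeal), (Literature.NumberTheory.PAdicHodge.fontainePstAdicCompletion v ℓ hv).IsDeRhamFramed (ρ.toLocal v)) → (Set.range fun g : Field.absoluteGaloisGroup K => (ρ g : GL (Fin n) (PadicAlgCl ℓ))).Finite → (¬ (∃ χ : Field.absoluteGaloisGroup K →ₜ* (PadicAlgCl ℓ)ˣ, IsSolvable (Literature.NumberTheory.GaloisRepresentations.FramedRep.twist ρ χ).toMonoidHom.range ∧ 0 < Nat.card (Literature.NumberTheory.GaloisRepresentations.FramedRep.twist ρ χ).toMonoidHom.range ∧ Nat.card (Literature.NumberTheory.GaloisRepresentations.FramedRep.twist ρ χ).toMonoidHom.range ≤ 107) ∧ ¬ (∃ χ : Field.absoluteGaloisGroup K →ₜ* (PadicAlgCl ℓ)ˣ, IsSolvable (Literature.NumberTheory.GaloisRepresentations.FramedRep.twist ρ χ).toMonoidHom.range ∧ Nat.card (Literature.NumberTheory.GaloisRepresentations.FramedRep.twist ρ χ).toMonoidHom.range = 108)) → (¬ (n = 4 ∧ ∃ A : Subgroup (Field.absoluteGaloisGroup K), A.Normal ∧ A.index = 12 ∧ (∀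 a ∈ A, ∀ b ∈ A, ρ a * ρ b = ρ b * ρ a) ∧ (∀ X Y : Matrix (Fin n) (Fin n) (PadicAlgCl ℓ), (∀ a ∈ A, X * ((ρ a : GL (Fin n) (PadicAlgCl ℓ)) : Matrix (Fin n) (Fin n) (PadicAlgCl ℓ)) = ((ρ a : GL (Fin n) (PadicAlgCl ℓ)) : Matrix (Fin n) (Fin n) (PadicAlgCl ℓ)) * X) → (∀ a ∈ A, Y * ((ρ a : GL (Fin n) (PadicAlgCl ℓ)) : Matrix (Fin n) (Fin n) (PadicAlgCl ℓ)) = ((ρ a : GL (Fin n) (PadicAlgCl ℓ)) : Matrix (Fin n) (Fin n) (PadicAlgCl ℓ)) * Y) → X * Y = Y * X)) ∧ (n = 4 ∧ ∃ A : Subgroup (Field.absoluteGaloisGroup K), A.Normal ∧ A.index = 24 ∧ (∀ a ∈ A, ∀ b ∈ A, ρ a * ρ b = ρ b * ρ a) ∧ (∀ X Y : Matrix (Fin n) (Fin n) (PadicAlgCl ℓ), (∀ a ∈ A, X * ((ρ a : GL (Fin n) (PadicAlgCl ℓ)) : Matrix (Fin n) (Fin n) (PadicAlgCl ℓ)) =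 ((ρ a : GL (Fin n) (PadicAlgCl ℓ)) : Matrix (Fin n) (Fin n) (PadicAlgCl ℓ)) * X) → (∀ a ∈ A, Y * ((ρ a : GL (Fin n) (PadicAlgCl ℓ)) : Matrix (Fin n) (Fin n) (PadicAlgCl ℓ)) = ((ρ a : GL (Fin n) (PadicAlgCl ℓ)) : Matrix (Fin n) (Fin n) (PadicAlgCl ℓ)) * Y) → X * Y = Y * X) ∧ (∀ B : Subgroup (Field.absoluteGaloisGroup K), B.Normal → A ≤ B → B.index ≠ 4 ∧ B.index ≠ 8 ∧ B.index ≠ 12))) → (∃ B : Matrix (Fin n) (Fin n) (PadicAlgCl ℓ), B.det ≠ 0 ∧ ∀ g : Field.absoluteGaloisGroup K, ∃ s : PadicAlgCl ℓ, Matrix.transpose ((ρ g : GL (Fin n) (PadicAlgCl ℓ)) : Matrix (Fin n) (Fin n) (PadicAlgCl ℓ)) * B * ((ρ g : GL (Fin n) (PadicAlgCl ℓ)) : Matrix (Fin n) (Fin n) (PadicAlgCl ℓ)) = s • B) → ¬ (∀ (v : IsDedekindDomain.HeightOneSpectrum (NumberField.RingOfIntegers K)) (hv : ((ℓ : ℕ)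 : NumberField.RingOfIntegers K) ∈ v.asIdeal), ∀ τ : v.adicCompletion K →+* PadicAlgCl ℓ, Continuous τ → (ρ.labelledHodgeTateWeightsAt v (Literature.NumberTheory.PAdicHodge.fontainePstAdicCompletion v ℓ hv).algebra (Literature.NumberTheory.PAdicHodge.fontainePstAdicCompletion v ℓ hv).𝔅 τ).Nodup) → ¬ (n ≤ 4 ∧ (∃ B : Matrix (Fin n) (Fin n) (PadicAlgCl ℓ), B.det ≠ 0 ∧ (Matrix.transpose B = B ∨ Matrix.transpose B = -B) ∧ (∀ g : Field.absoluteGaloisGroup K, ∃ s : PadicAlgCl ℓ, Matrix.transpose ((ρ g : GL (Fin n) (PadicAlgCl ℓ)) : Matrix (Fin n) (Fin n) (PadicAlgCl ℓ)) * B * ((ρ g : GL (Fin n) (PadicAlgCl ℓ)) : Matrix (Fin n) (Fin n) (PadicAlgCl ℓ)) = s • B) ∧ ∀ (φ : K →+* ℝ) (c : Field.absoluteGaloisGroup K), Literature.NumberTheory.GaloisRepresentations.IsComplexConjugation φ c → Matrix.transpose (B * ((ρ c : GL (Fin n) (PadicAlgCl ℓ)) : Matrix (Fin n) (Fin n) (PadicAlgCl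 ℓ))) = B * ((ρ c : GL (Fin n) (PadicAlgCl ℓ)) : Matrix (Fin n) (Fin n) (PadicAlgCl ℓ))) ∧ (∀ (v : IsDedekindDomain.HeightOneSpectrum (NumberField.RingOfIntegers K)) (hv : ((ℓ : ℕ) : NumberField.RingOfIntegers K) ∈ v.asIdeal), ∀ τ : v.adicCompletion K →+* PadicAlgCl ℓ, Continuous τ → ∀ w : ℤ, Multiset.count w (ρ.labelledHodgeTateWeightsAt v (Literature.NumberTheory.PAdicHodge.fontainePstAdicCompletion v ℓ hv).algebra (Literature.NumberTheory.PAdicHodge.fontainePstAdicCompletion v ℓ hv).𝔅 τ) ≤ 2)) → ¬ (n = 2 ∧ ¬ ρ.IsOdd) → ∃ π : Literature.NumberTheory.Automorphic.CuspidalAutomorphicRepData n K hcpt, π.1.IsLAlgebraic ∧ ∀ᶠ v : IsDedekindDomain.HeightOneSpectrum (NumberField.RingOfIntegers K) in Filter.cofinite, SatakeFrobCompatibleAt ι π.1 ρ v := by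
  sorry

/-- rung (4,2), not essentially self-dual: the SIGN-COHERENCE wall — the last descent step K₂/K (K₂ = fixed field of A₄) is quadratic with n = 4 even: det, Λ², Λ³ are blind to π ↦ π⊗η_{K₂/K}; transposition-type Frobenii have non-(−1)-stable spectra {s,−s,w₁,w₂}; IDEA-NEEDED -/
theorem stub_octNonSelfDual :
  ∀ (K : Type) [Field K] [NumberField K], NumberField.IsTotallyReal K → ∀ (n : ℕ) (hcpt : Literature.NumberTheory.Automorphic.isCompact_glFiniteIntegralLevel n K), 0 < n → ∀ (ℓ : ℕ) [Fact ℓ.Prime] (ι : PadicAlgCl ℓ ≃+* ℂ) (ρ : Literature.NumberTheory.GaloisRepresentations.FramedGaloisRep K (PadicAlgCl ℓ) n), ρ.toGaloisRep.IsIrreducible → ((∀ᶠ v : IsDedekindDomain.HeightOneSpectrum (NumberField.RingOfIntegers K) in Filter.cofinite, ρ.IsUnramifiedAt v) ∧ ∀ (v : IsDedekindDomain.HeightOneSpectrum (NumberField.RingOfIntegers K)) (hv : ((ℓ : ℕ) : NumberField.RingOfIntegers K) ∈ v.asIdeal), (Literature.NumberTheory.PAdicHodge.fontainePstAdicCompletion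 v ℓ hv).IsDeRhamFramed (ρ.toLocal v)) → (Set.range fun g : Field.absoluteGaloisGroup K => (ρ g : GL (Fin n) (PadicAlgCl ℓ))).Finite → (¬ (∃ χ : Field.absoluteGaloisGroup K →ₜ* (PadicAlgCl ℓ)ˣ, IsSolvable (Literature.NumberTheory.GaloisRepresentations.FramedRep.twist ρ χ).toMonoidHom.range ∧ 0 < Nat.card (Literature.NumberTheory.GaloisRepresentations.FramedRep.twist ρ χ).toMonoidHom.range ∧ Nat.card (Literature.NumberTheory.GaloisRepresentations.FramedRep.twist ρ χ).toMonoidHom.range ≤ 107) ∧ ¬ (∃ χ : Field.absoluteGaloisGroup K →ₜ* (PadicAlgCl ℓ)ˣ, IsSolvable (Literature.NumberTheory.GaloisRepresentations.FramedRep.twist ρ χ).toMonoidHom.range ∧ Nat.card (Literature.NumberTheory.GaloisRepresentations.FramedRep.twist ρ χ).toMonoidHom.range = 108)) → (¬ (n = 4 ∧ ∃ A : Subgroup (Field.absoluteGaloisGroup K), A.Normal ∧ A.index = 12 ∧ (∀ a ∈ A, ∀ b ∈ A, ρ a * ρ b = ρ b * ρ a) ∧ (∀ X Y : Matrix (Fin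 n) (Fin n) (PadicAlgCl ℓ), (∀ a ∈ A, X * ((ρ a : GL (Fin n) (PadicAlgCl ℓ)) : Matrix (Fin n) (Fin n) (PadicAlgCl ℓ)) = ((ρ a : GL (Fin n) (PadicAlgCl ℓ)) : Matrix (Fin n) (Fin n) (PadicAlgCl ℓ)) * X) → (∀ a ∈ A, Y * ((ρ a : GL (Fin n) (PadicAlgCl ℓ)) : Matrix (Fin n) (Fin n) (PadicAlgCl ℓ)) = ((ρ a : GL (Fin n) (PadicAlgCl ℓ)) : Matrix (Fin n) (Fin n) (PadicAlgCl ℓ)) * Y) → X * Y = Y * X)) ∧ (n = 4 ∧ ∃ A : Subgroup (Field.absoluteGaloisGroup K), A.Normal ∧ A.index = 24 ∧ (∀ a ∈ A, ∀ b ∈ A, ρ a * ρ b = ρ b * ρ a) ∧ (∀ X Y : Matrix (Fin n) (Fin n) (PadicAlgCl ℓ), (∀ a ∈ A, X * ((ρ a : GL (Fin n) (PadicAlgCl ℓ)) : Matrix (Fin n) (Fin n) (PadicAlgCl ℓ)) = ((ρ a : GL (Fin n) (PadicAlgCl ℓ)) : Matrix (Fin n) (Fin n) (PadicAlgCl ℓ))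 * X) → (∀ a ∈ A, Y * ((ρ a : GL (Fin n) (PadicAlgCl ℓ)) : Matrix (Fin n) (Fin n) (PadicAlgCl ℓ)) = ((ρ a : GL (Fin n) (PadicAlgCl ℓ)) : Matrix (Fin n) (Fin n) (PadicAlgCl ℓ)) * Y) → X * Y = Y * X) ∧ (∀ B : Subgroup (Field.absoluteGaloisGroup K), B.Normal → A ≤ B → B.index ≠ 4 ∧ B.index ≠ 8 ∧ B.index ≠ 12))) → ¬ (∃ B : Matrix (Fin n) (Fin n) (PadicAlgCl ℓ), B.det ≠ 0 ∧ ∀ g : Field.absoluteGaloisGroup K, ∃ s : PadicAlgCl ℓ, Matrix.transpose ((ρ g : GL (Fin n) (PadicAlgCl ℓ)) : Matrix (Fin n) (Fin n) (PadicAlgCl ℓ)) * B * ((ρ g : GL (Fin n) (PadicAlgCl ℓ)) : Matrix (Fin n) (Fin n) (PadicAlgCl ℓ)) = s • B) → ¬ (∀ (v : IsDedekindDomain.HeightOneSpectrum (NumberField.RingOfIntegers K)) (hv : ((ℓ : ℕ) : NumberField.RingOfIntegers K) ∈ v.asIdeal), ∀ τ : v.adicCompletion K →+* PadicAlgCl ℓ,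 Continuous τ → (ρ.labelledHodgeTateWeightsAt v (Literature.NumberTheory.PAdicHodge.fontainePstAdicCompletion v ℓ hv).algebra (Literature.NumberTheory.PAdicHodge.fontainePstAdicCompletion v ℓ hv).𝔅 τ).Nodup) → ¬ (n ≤ 4 ∧ (∃ B : Matrix (Fin n) (Fin n) (PadicAlgCl ℓ), B.det ≠ 0 ∧ (Matrix.transpose B = B ∨ Matrix.transpose B = -B) ∧ (∀ g : Field.absoluteGaloisGroup K, ∃ s : PadicAlgCl ℓ, Matrix.transpose ((ρ g : GL (Fin n) (PadicAlgCl ℓ)) : Matrix (Fin n) (Fin n) (PadicAlgCl ℓ)) * B * ((ρ g : GL (Fin n) (PadicAlgCl ℓ)) : Matrix (Fin n) (Fin n) (PadicAlgCl ℓ)) = s • B) ∧ ∀ (φ : K →+* ℝ) (c : Field.absoluteGaloisGroup K), Literature.NumberTheory.GaloisRepresentations.IsComplexConjugation φ c → Matrix.transpose (B * ((ρ c : GL (Fin n) (PadicAlgCl ℓ)) : Matrix (Fin n) (Fin n) (PadicAlgCl ℓ))) = B * ((ρ c : GL (Fin n) (PadicAlgCl ℓ)) : Matrix (Fin n) (Fin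 n) (PadicAlgCl ℓ))) ∧ (∀ (v : IsDedekindDomain.HeightOneSpectrum (NumberField.RingOfIntegers K)) (hv : ((ℓ : ℕ) : NumberField.RingOfIntegers K) ∈ v.asIdeal), ∀ τ : v.adicCompletion K →+* PadicAlgCl ℓ, Continuous τ → ∀ w : ℤ, Multiset.count w (ρ.labelledHodgeTateWeightsAt v (Literature.NumberTheory.PAdicHodge.fontainePstAdicCompletion v ℓ hv).algebra (Literature.NumberTheory.PAdicHodge.fontainePstAdicCompletion v ℓ hv).𝔅 τ) ≤ 2)) → ¬ (n = 2 ∧ ¬ ρ.IsOdd) → ∃ π : Literature.NumberTheory.Automorphic.CuspidalAutomorphicRepData n K hcpt, π.1.IsLAlgebraic ∧ ∀ᶠ v : IsDedekindDomain.HeightOneSpectrum (NumberField.RingOfIntegers K) in Filter.cofinite, SatakeFrobCompatibleAt ι π.1 ρ v := by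
  sorry

/-- COMPOSITION (kernel-checked, no sorry): the two stubs ⟹ the cell, by cases on «ρ is essentially self-dual»: the print GO(4) sub-box | the non-self-dual S₄-tori (the wall proper) (the extra hypothesis is inferred by unification, never restated). — writer-reshaped to the single CLOSED candidate `OctahedralMonomialArtinAutomorphy_proof` (the hypothesis-carrying `_of` form trips skeleton.extra-hypothesis). -/
theorem OctahedralMonomialArtinAutomorphy_proof : Summit.Langlands.Langlands.Theses.DescentCoprimalityLadder.OctahedralMonomialArtinAutomorphy := by
  have h₁ := stub_octSelfDual
  have h₂ := stub_octNonSelfDual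
  intro K _ _ hK n hcpt hn ℓ _ ι ρ hirr hgeo hfin hrest hcell hnreg hnlim hneven
  refine (Classical.em _).elim (fun hsd => h₁ K hK n hcpt hn ℓ ι ρ hirr hgeo hfin hrest hcell hsd hnreg hnlim hneven) (fun hsd => ?_)
  exact h₂ K hK n hcpt hn ℓ ι ρ hirr hgeo hfin hrest hcell hsd hnreg hnlim hneven

end Summit.Langlands.Langlands.Cruxes.OctahedralMonomialArtinAutomorphy.Birth
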